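import Summits.QuantumFields.YangMills.Theorems.BalabanUVNodesN09CentralWindowForwardLawAtRecord
import HarnessLib

/-!
# BalabanUVNodes ∕ N09 — ROAD A′'s WINDOW RADIUS IS NOT A LETTER OF THE RECORD: the injectivity clause `hgap` is a theorem of `157·α < L^{−(d−1)}`, the whole
# `α`-package is inhabited iff three `ε₀`-lines in `(d, L, N)` hold, and the remaining numerics are jointly inhabited

Cell `pub-ymgap` (YM-PLAN Track A), width seat `pub-ymgap-dag-n09-w4` g6 (FILE 1 = INTENT-1); count-neutral helper of K1⁹ `StabilityBRunRowsAtRecordR13SepCoPHV` =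
stmt-QuantumFields-27364 (`--supports`, `--as helper`).  [I] = [Balaban1987RG1] (CMP 109).

WHY.  After dag-n09-w5 g5's `…N09TowerOfForwardLawsOfNumerics` (p638367) and their announced last plug `…N09TowerOfNumericsAtRecord`, the road-A′ supplier of N09's analytic
inclusion `hreg_j ∧ (F3)_j` and N09's Theorem-3 door display — besides `hsolν hcrit hU hint` and the Stage-13 numerics — the AUXILIARY window radius `α` of the private-coordinate
road through six clauses: `0 ≤ α`, `α ≤ 1∕24`, `64·α ≤ δ_N` (⇒ `α < δ_N`), `157·α < (L^{d−1})⁻¹`, the injectivity clause `hgap : offCard c∕|Idx| + 150·α < 1` at every coarse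
bond of every level, and the STRICT margin `(((d+2)L)²∕4)·ε₀ < α`.  `α` is a radius of the PROOF, not of the record.  THIS FILE removes it:
(a) §1 — `hgap` IS A THEOREM of `157·α < (L^{d−1})⁻¹` (indeed of `150·α < (L^{d−1})⁻¹`, sharp): `offCard c∕|Idx| = 1 − (L^{d−1})⁻¹` EXACTLY, because the central indices of the
(0.4) average at `c` are the on-axis ones, whose fraction is `λ = L^{1−d}` (lit `B12B0RestrictionNonlinear267.onAxis_ratio_eq`);
(b) §2 — the `α`-package is INHABITED IFF `m := (((d+2)L)²∕4)·ε₀` satisfies THREE LINES in `(d, L, N)` alone: `m < 1∕24`, `64·m < δ_N`, `157·m < (L^{d−1})⁻¹`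
(`exists_windowRadius_of_ε₀` ∕ `windowRadius_lines_of_exists`);
(c) §3 — this seat's g5 forward-law package (`exists_jacobian_forwardLaws(_continuousOn)`, 6d₃) with `hgap` DISCHARGED;
(d) §4 — A6 (№189): the three lines TOGETHER WITH dag-n09-w4 g3's seven numerics (`hε3 hε2 hn1 hn2 hord`, `0 < εreg`, `0 < ε₂₉`) and `((d·L)²∕4)·ε₀ < δ_Fed` are JOINTLY
inhabited by some `(εreg, ε₂₉, ε₀) > 0`, for every dimension `d`, block size `L ≥ 1` and every pair of positive radii `(δ_N, δ_Fed)` — pure real arithmetic; it says NOTHING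
about the numerics OF RECORD (K0-numerics lane), only that the `α`-free door is not vacuous for numeric reasons.

WHAT IS PROVED (theorems only; 0 def, 0 instance, 0 notation, 0 sorry).
§1 `isCentral_iff_onAxis` · `nCentral_eq_card_onAxis` · `nCentral_div_card_eq` · `offCard_add_nCentral` · ★ `offCard_div_card_eq` · ★ `hgap_iff` · ★★ `hgap_of_lt` · ★★ `hgap_of_hαL` ·
`hgap_levels_of_hαL` (the tower's `∀ j < K, ∀ c` shape).  §2 `exists_windowRadius_real` · `windowRadius_lines_of_exists` · ★★ `exists_windowRadius_of_ε₀` (record currency, with the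
`hgap` clause at every level included).  §3 ★ `exists_jacobian_forwardLaws_continuousOn_of_hαL` · `exists_jacobian_forwardLaws_of_hαL`.  §4 ★ `numerics_inhabited`.

HONEST FRAMING.  Count-neutral BOOKKEEPING (finite combinatorics of the (0.4) index set + real arithmetic) BY NAME; nothing of Bałaban's estimates asserted or denied; no numerics
row OF RECORD is claimed to meet the lines; `hreg` NOT discharged; N09 NOT discharged; conjunct 1 (Lemma 4) ∕ FLAG №7 untouched; K0⁷ ∕ K1⁹ ∕ K3⁸ NOT closed; counts unmoved
(typed 28∕28 · discharged 5∕28); no summit statement is proved here; one finite four-torus programme at fixed `ε = L^{−K}` per run — R4 closes the conditional rung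
`BalabanLadder.UV` only; NOT continuum ∕ ℝ⁴ ∕ infinite volume ∕ OS; the Yang–Mills mass gap (Clay) is NOT proved by any of this.
-/

noncomputable section

open scoped ENNReal NNReal Topology
open Filter Set Function MeasureTheory

namespace Summit.QuantumFields.YangMills.BalabanUVNodes.N09WindowRadiusOfRecord

open Literature.MathematicalPhysics.QuantumFieldTheory.Balaban1983to89
open Literature.MathematicalPhysics.QuantumFieldTheory.Balaban1983to89.BlockAveraging (Idx avgFun off)
open Literature.MathematicalPhysics.QuantumFieldTheory.Balaban1983to89.BlockAveragingHaarAC (centralBond pre post IsCentral nCentral)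
open Literature.MathematicalPhysics.QuantumFieldTheory.Balaban1983to89.BlockAveragingEMLHaarAC (fibreFamily offCard)
open Literature.MathematicalPhysics.QuantumFieldTheory.Balaban1983to89.ExpMeanLog (expMeanLogSU deltaSU deltaSU_pos)
open Literature.MathematicalPhysics.QuantumFieldTheory.Balaban1983to89.B12B0RestrictionNonlinear267 (onAxis_ratio_eq)
open Literature.MathematicalPhysics.QuantumFieldTheory.Balaban1983to89.T4Continuum (T4Family)
open Literature.MathematicalPhysics.QuantumFieldTheory.Balaban1983to89.Node00
open Summit.QuantumFields.YangMills.BalabanUVNodes.N09CentralWindowInjective (offCard_eq_card_filter)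
open Summit.QuantumFields.YangMills.BalabanUVNodes.N09CentralWindowForwardLawAtRecord (exists_jacobian_forwardLaws exists_jacobian_forwardLaws_continuousOn)

variable {P : Params} {j : ℕ}

/-! ## §1  Counting the central indices: `offCard c ∕ |Idx| = 1 − L^{−(d−1)}`, hence `hgap` from `157·α < L^{−(d−1)}` -/

section Count

/-- The central indices of (0.4) at a coarse bond `c` are exactly the ON-AXIS indices (transverse label `(L−1)∕2` in every direction `ν ≠ dir c`).
[cite: Balaban1987RG1, (0.4) p.253 (bookkeeping)] -/
theorem isCentral_iff_onAxis (c : PBond P (j + 1)) (i : Idx P) :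
    IsCentral c i ↔ ∀ ν, ν ≠ c.dir → ((i.1 ν : ℕ)) = (P.L - 1) / 2 := by
  refine forall_congr' fun ν => imp_congr_right fun _ => ?_
  show ((i.1 ν : ℕ) : ℤ) - (((P.L - 1) / 2 : ℕ) : ℤ) = 0 ↔ _
  rw [sub_eq_zero, Nat.cast_inj]

/-- The number of central indices is the number of on-axis indices. [cite: Balaban1987RG1, (0.4) p.253 (bookkeeping)] -/
theorem nCentral_eq_card_onAxis (c : PBond P (j + 1)) :
    nCentral c = (Finset.univ.filter fun i : Idx P => ∀ ν, ν ≠ c.dir → ((i.1 ν : ℕ)) = (P.L - 1) / 2).card := by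
  unfold nCentral
  exact congrArg Finset.card (Finset.filter_congr fun i _ => isCentral_iff_onAxis c i)

/-- **`N_c ∕ |Idx| = L^{−(d−1)}`**: the central fraction is the on-axis fraction `λ = L^{1−d}` (lit `onAxis_ratio_eq`). [cite: Balaban1987RG1, (0.4) p.253 (bookkeeping)] -/
theorem nCentral_div_card_eq (c : PBond P (j + 1)) :
    (nCentral c : ℝ) / (Fintype.card (Idx P) : ℝ) = (((P.L : ℝ)) ^ (P.d - 1))⁻¹ := by
  rw [nCentral_eq_card_onAxis]
  exact onAxis_ratio_eq (P := P) c.dir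

/-- `offCard c + N_c = |Idx|`. [cite: Balaban1987RG1, (0.4) p.253 (bookkeeping)] -/
theorem offCard_add_nCentral (c : PBond P (j + 1)) : offCard c + nCentral c = Fintype.card (Idx P) := by
  rw [offCard_eq_card_filter, add_comm]
  unfold nCentral
  rw [Finset.card_filter_add_card_filter_not, Finset.card_univ]

/-- ★ **`offCard c ∕ |Idx| = 1 − L^{−(d−1)}` EXACTLY**, at every coarse bond. [cite: Balaban1987RG1, (0.4) p.253 (bookkeeping)] -/
theorem offCard_div_card_eq (c : PBond P (j + 1)) :
    (offCard c : ℝ) / (Fintype.card (Idx P) : ℝ) = 1 - (((P.L : ℝ)) ^ (P.d - 1))⁻¹ := by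
  have hI : (0 : ℝ) < Fintype.card (Idx P) := by exact_mod_cast Fintype.card_pos
  have h : (offCard c : ℝ) + nCentral c = Fintype.card (Idx P) := by exact_mod_cast offCard_add_nCentral c
  rw [← nCentral_div_card_eq c, eq_sub_iff_add_eq, ← add_div, h, div_self hI.ne']

/-- ★ The injectivity clause of the private-coordinate road is EQUIVALENT to `150·α < L^{−(d−1)}`. [cite: Balaban1987RG1, (0.4) p.253 (bookkeeping)] -/
theorem hgap_iff (c : PBond P (j + 1)) {α : ℝ} :
    (offCard c : ℝ) / (Fintype.card (Idx P) : ℝ) + 150 * α < 1 ↔ 150 * α < (((P.L : ℝ)) ^ (P.d - 1))⁻¹ := by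
  rw [offCard_div_card_eq]
  constructor <;> intro h <;> linarith

/-- ★★ `hgap` FROM `150·α < L^{−(d−1)}` (sharp form). [cite: Balaban1987RG1, (0.4) p.253 (bookkeeping)] -/
theorem hgap_of_lt {α : ℝ} (h : 150 * α < (((P.L : ℝ)) ^ (P.d - 1))⁻¹) (c : PBond P (j + 1)) :
    (offCard c : ℝ) / (Fintype.card (Idx P) : ℝ) + 150 * α < 1 :=
  (hgap_iff c).2 h

/-- ★★ **`hgap` IS A THEOREM OF THE DISPLAYED `hαL : 157·α < L^{−(d−1)}`** (`0 ≤ α`): the clause `offCard c∕|Idx| + 150·α < 1` of this seat's 6d₃ package, of dag-n09-w6's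
`exists_perBondCharts_of_forwardLaws(_sharp)` ∕ `exists_jacobianLetters_record` and of dag-n09-w5's towers holds at every coarse bond. [cite: Balaban1987RG1, (0.4) p.253 (bookkeeping)] -/
theorem hgap_of_hαL {α : ℝ} (hα0 : 0 ≤ α) (hαL : 157 * α < (((P.L : ℝ)) ^ (P.d - 1))⁻¹) (c : PBond P (j + 1)) :
    (offCard c : ℝ) / (Fintype.card (Idx P) : ℝ) + 150 * α < 1 :=
  hgap_of_lt (by linarith) c

/-- `hgap` in the tower's `∀ j < K, ∀ c` currency on `F.P K`. [cite: Balaban1987RG1, (0.4) p.253 (bookkeeping)] -/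
theorem hgap_levels_of_hαL {F : T4Family} (K : ℕ) {α : ℝ} (hα0 : 0 ≤ α) (hαL : 157 * α < ((((F.P K).L : ℝ)) ^ ((F.P K).d - 1))⁻¹) :
    ∀ j < K, ∀ c : PBond (F.P K) (j + 1), (offCard c : ℝ) / (Fintype.card (Idx (F.P K)) : ℝ) + 150 * α < 1 :=
  fun _ _ c => hgap_of_hαL hα0 hαL c

end Count

/-! ## §2  The `α`-package is inhabited iff three `ε₀`-lines hold -/

section Radius

/-- Pure arithmetic: a margin `m ≥ 0` admits a radius `α` with `m < α`, `0 ≤ α ≤ 1∕24`, `64·α ≤ δ`, `α < δ`, `157·α < ℓ` as soon as `m < 1∕24`, `64·m < δ`, `157·m < ℓ`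
(`α := (m + min (1∕24) (min (δ∕64) (ℓ∕157)))∕2`). [cite: Balaban1987RG1, (2.9)–(2.10) pp.266–267 (bookkeeping)] -/
theorem exists_windowRadius_real {m δ ℓ : ℝ} (hm : 0 ≤ m) (h24 : m < 1 / 24) (h64 : 64 * m < δ) (hL : 157 * m < ℓ) :
    ∃ α : ℝ, m < α ∧ 0 ≤ α ∧ α ≤ 1 / 24 ∧ 64 * α ≤ δ ∧ α < δ ∧ 157 * α < ℓ := by
  obtain ⟨b, hb24, hb64, hbL, hmb⟩ : ∃ b : ℝ, b ≤ 1 / 24 ∧ b ≤ δ / 64 ∧ b ≤ ℓ / 157 ∧ m < b :=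
    ⟨min (1 / 24) (min (δ / 64) (ℓ / 157)), min_le_left _ _, (min_le_right _ _).trans (min_le_left _ _),
      (min_le_right _ _).trans (min_le_right _ _), lt_min h24 (lt_min (by linarith) (by linarith))⟩
  refine ⟨(m + b) / 2, by linarith, by linarith, by linarith, by linarith, ?_, by linarith⟩
  have : 64 * ((m + b) / 2) < δ := by linarith
  linarith

/-- Converse bookkeeping: the three lines are NECESSARY for the `α`-package (so §2 loses nothing). [cite: Balaban1987RG1, (2.9)–(2.10) pp.266–267 (bookkeeping)] -/
theorem windowRadius_lines_of_exists {m δ ℓ α : ℝ} (hmα : m < α) (h24 : α ≤ 1 / 24) (h64 : 64 * α ≤ δ) (hL : 157 * α < ℓ) :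
    m < 1 / 24 ∧ 64 * m < δ ∧ 157 * m < ℓ :=
  ⟨by linarith, by linarith, by linarith⟩

variable {N : ℕ}

/-- ★★ **THE `α`-PACKAGE OF ROAD A′ FROM THREE `ε₀`-LINES** (record currency on `F.P K`; `m = (((d+2)L)²∕4)·ε₀`): `m < 1∕24`, `64·m < δ_N`, `157·m < (L^{d−1})⁻¹` give a radius
`α` with the STRICT margin `m < α`, `0 ≤ α ≤ 1∕24`, `64·α ≤ δ_N`, `α < δ_N`, `157·α < (L^{d−1})⁻¹` AND the injectivity clause `hgap` at every level and every coarse bond (§1).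
[cite: Balaban1987RG1, (0.4) p.253 and (2.9)–(2.10) pp.266–267 (bookkeeping)] -/
theorem exists_windowRadius_of_ε₀ {F : T4Family} (K : ℕ) {ε₀ : ℝ} (hε₀ : 0 ≤ ε₀)
    (h24 : ((((F.P K).d + 2) * (F.P K).L : ℕ) : ℝ) ^ 2 / 4 * ε₀ < 1 / 24)
    (h64 : 64 * (((((F.P K).d + 2) * (F.P K).L : ℕ) : ℝ) ^ 2 / 4 * ε₀) < deltaSU (Fin N))
    (hL : 157 * (((((F.P K).d + 2) * (F.P K).L : ℕ) : ℝ) ^ 2 / 4 * ε₀) < ((((F.P K).L : ℝ)) ^ ((F.P K).d - 1))⁻¹) :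
    ∃ α : ℝ, ((((F.P K).d + 2) * (F.P K).L : ℕ) : ℝ) ^ 2 / 4 * ε₀ < α ∧ 0 ≤ α ∧ α ≤ 1 / 24 ∧ 64 * α ≤ deltaSU (Fin N) ∧ α < deltaSU (Fin N) ∧
      157 * α < ((((F.P K).L : ℝ)) ^ ((F.P K).d - 1))⁻¹ ∧
      ∀ j < K, ∀ c : PBond (F.P K) (j + 1), (offCard c : ℝ) / (Fintype.card (Idx (F.P K)) : ℝ) + 150 * α < 1 := by
  obtain ⟨α, hmα, hα0, hα24, hα64, hαδ, hαL⟩ :=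
    exists_windowRadius_real (by positivity) h24 h64 hL
  exact ⟨α, hmα, hα0, hα24, hα64, hαδ, hαL, hgap_levels_of_hαL K hα0 hαL⟩

end Radius

/-! ## §3  This seat's forward-law package (6d₃) with `hgap` discharged -/

section Package

variable {N : ℕ} [NeZero N]

/-- ★ 6d₃'s `exists_jacobian_forwardLaws_continuousOn` (four clauses) with the injectivity clause `hgap` DISCHARGED by §1.
[cite: Balaban1987RG1, (0.4) p.253 and (2.10) p.267; Helgason2000, Ch. I §1 Thm. 1.14 (12)-(13) p. 96] -/
theorem exists_jacobian_forwardLaws_continuousOn_of_hαL (hj : j + 1 ≤ P.m + P.K) {α : ℝ} (hα0 : 0 ≤ α) (hα24 : α ≤ 1 / 24)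
    (hα64 : 64 * α ≤ deltaSU (Fin N)) (hαL : 157 * α < ((P.L : ℝ) ^ (P.d - 1))⁻¹) :
    ∃ jac : PBond P (j + 1) → GaugeField P j (SU N) → SU N → ℝ≥0,
      (∀ c, Measurable fun p : GaugeField P j (SU N) × SU N => jac c p.1 p.2) ∧
      (∀ c U g, (∀ i : Idx P, dist1 (fibreFamily U c (pre U c * g * post U c) i) ≤ α) → jac c U g ≠ 0) ∧
      (∀ c U, (HaarData.haar : Measure (SU N)).restrict ((fun g : SU N => avgFun (expMeanLogSU (n := Fin N)) (update U (centralBond c) g) c) ''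
            {g : SU N | ∀ i : Idx P, dist1 (fibreFamily U c (pre U c * g * post U c) i) ≤ α}) =
        Measure.map (fun g : SU N => avgFun (expMeanLogSU (n := Fin N)) (update U (centralBond c) g) c)
          (((HaarData.haar : Measure (SU N)).restrict {g : SU N | ∀ i : Idx P, dist1 (fibreFamily U c (pre U c * g * post U c) i) ≤ α}).withDensity
            fun g => (jac c U g : ℝ≥0∞))) ∧
      (∀ c U, ContinuousOn (jac c U) {g : SU N | ∀ i : Idx P, dist1 (fibreFamily U c (pre U c * g * post U c) i) ≤ α}) :=
  exists_jacobian_forwardLaws_continuousOn (N := N) hj hα0 hα24 hα64 hαL (hgap_of_hαL hα0 hαL)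

/-- 6d₃'s `exists_jacobian_forwardLaws` (three clauses `hjacm hjac0 hfwd`) with `hgap` DISCHARGED by §1.
[cite: Balaban1987RG1, (0.4) p.253 and (2.10) p.267; Helgason2000, Ch. I §1 Thm. 1.14 (12)-(13) p. 96] -/
theorem exists_jacobian_forwardLaws_of_hαL (hj : j + 1 ≤ P.m + P.K) {α : ℝ} (hα0 : 0 ≤ α) (hα24 : α ≤ 1 / 24)
    (hα64 : 64 * α ≤ deltaSU (Fin N)) (hαL : 157 * α < ((P.L : ℝ) ^ (P.d - 1))⁻¹) :
    ∃ jac : PBond P (j + 1) → GaugeField P j (SU N) → SU N → ℝ≥0,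
      (∀ c, Measurable fun p : GaugeField P j (SU N) × SU N => jac c p.1 p.2) ∧
      (∀ c U g, (∀ i : Idx P, dist1 (fibreFamily U c (pre U c * g * post U c) i) ≤ α) → jac c U g ≠ 0) ∧
      (∀ c U, (HaarData.haar : Measure (SU N)).restrict ((fun g : SU N => avgFun (expMeanLogSU (n := Fin N)) (update U (centralBond c) g) c) ''
            {g : SU N | ∀ i : Idx P, dist1 (fibreFamily U c (pre U c * g * post U c) i) ≤ α}) =
        Measure.map (fun g : SU N => avgFun (expMeanLogSU (n := Fin N)) (update U (centralBond c) g) c)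
          (((HaarData.haar : Measure (SU N)).restrict {g : SU N | ∀ i : Idx P, dist1 (fibreFamily U c (pre U c * g * post U c) i) ≤ α}).withDensity
            fun g => (jac c U g : ℝ≥0∞))) :=
  exists_jacobian_forwardLaws (N := N) hj hα0 hα24 hα64 hαL (hgap_of_hαL hα0 hαL)

end Package

/-! ## §4  A6: the `α`-free numerics package is jointly inhabited -/

section A6

/-- A real function continuous at `0` with value `0 < C` there is `< C` for all small `t > 0` — the one bookkeeping device of §4. [cite: Balaban1987RG1, (2.9) p.266 (bookkeeping)] -/
theorem eventually_nhdsGT_lt_of_continuousAt {g : ℝ → ℝ} (hg : ContinuousAt g 0) (h0 : g 0 = 0) {C : ℝ} (hC : 0 < C) :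
    ∀ᶠ t in 𝓝[>] (0 : ℝ), g t < C := by
  have h : ∀ᶠ t in 𝓝 (0 : ℝ), g t < C := hg.eventually_lt continuousAt_const (by rw [h0]; exact hC)
  exact nhdsWithin_le_nhds h

/-- ★ **A6 — THE `α`-FREE NUMERICS OF ROAD A′ ∕ N09's DOOR ARE JOINTLY INHABITED.**  For every dimension letter `d`, block size `L ≥ 1` and positive radii `δ` (read `δ_N`) and
`δF` (read `δ_Fed`), there are `εreg, ε₂₉, ε₀ > 0` meeting, VERBATIM in the tower's currency: dag-n09-w4 g3's `hε3 hε2 hn1 hn2 hord`, §2's three `ε₀`-lines, and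
`((d·L)²∕4)·ε₀ < δF`.  (Choose `ε₀` small first, then `εreg = ε₂₉ = t` small.)  Says NOTHING about the numerics of record. [cite: Balaban1987RG1, (2.9)–(2.10) pp.266–267 and (0.19) p.255 (bookkeeping)] -/
theorem numerics_inhabited (d L : ℕ) (hL : 1 ≤ L) {δ δF : ℝ} (hδ : 0 < δ) (hδF : 0 < δF) :
    ∃ εreg ε29 ε₀ : ℝ, 0 < εreg ∧ 0 < ε29 ∧ 0 < ε₀ ∧
      143 * (((((d + 4 : ℕ) : ℝ)) ^ 2 / 4) ^ 2) * εreg ≤ 1 / 3 ∧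
      2 * εreg ≤ 2 * δ / ((((d + 4) * L : ℕ) : ℝ)) ^ 2 ∧
      1640 * (2 * (((((d + 2) * L : ℕ) : ℝ)) * ε29) + ((((d + 2) * L : ℕ) : ℝ)) ^ 2 / 4 * (2 * εreg / (L : ℝ) ^ 2)) * (((L : ℝ)) ^ (d - 1)) ^ 2 ≤ 1 ∧
      13 * (2 * (((((d + 2) * L : ℕ) : ℝ)) * ε29) + ((((d + 2) * L : ℕ) : ℝ)) ^ 2 / 4 * (2 * εreg / (L : ℝ) ^ 2)) * ((L : ℝ)) ^ (d - 1) < δ ∧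
      2 * εreg / (L : ℝ) ^ 2 + 4 * max ε29 (10 * (((((d + 2) * L : ℕ) : ℝ)) * ε29) * ((L : ℝ)) ^ (d - 1)) ≤ ε₀ ∧
      ((((d + 2) * L : ℕ) : ℝ)) ^ 2 / 4 * ε₀ < 1 / 24 ∧
      64 * (((((d + 2) * L : ℕ) : ℝ)) ^ 2 / 4 * ε₀) < δ ∧
      157 * (((((d + 2) * L : ℕ) : ℝ)) ^ 2 / 4 * ε₀) < (((L : ℝ)) ^ (d - 1))⁻¹ ∧
      (((d * L : ℕ) : ℝ)) ^ 2 / 4 * ε₀ < δF := by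
  have hL0 : (0 : ℝ) < L := by exact_mod_cast hL
  have hΛ : (0 : ℝ) < (((L : ℝ)) ^ (d - 1))⁻¹ := inv_pos.mpr (pow_pos hL0 _)
  set A : ℝ := ((((d + 2) * L : ℕ) : ℝ)) ^ 2 / 4 with hA
  set B : ℝ := (((d * L : ℕ) : ℝ)) ^ 2 / 4 with hB
  -- STEP 1: `ε₀ > 0` small against the four `ε₀`-constraints
  obtain ⟨ε₀, hε₀, h24, h64, h157, hF⟩ : ∃ ε₀ : ℝ, 0 < ε₀ ∧ A * ε₀ < 1 / 24 ∧ 64 * (A * ε₀) < δ ∧ 157 * (A * ε₀) < (((L : ℝ)) ^ (d - 1))⁻¹ ∧ B * ε₀ < δF := by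
    have h1 := eventually_nhdsGT_lt_of_continuousAt (g := fun e : ℝ => A * e) (by fun_prop) (by simp) (C := 1 / 24) (by norm_num)
    have h2 := eventually_nhdsGT_lt_of_continuousAt (g := fun e : ℝ => 64 * (A * e)) (by fun_prop) (by simp) hδ
    have h3 := eventually_nhdsGT_lt_of_continuousAt (g := fun e : ℝ => 157 * (A * e)) (by fun_prop) (by simp) hΛ
    have h4 := eventually_nhdsGT_lt_of_continuousAt (g := fun e : ℝ => B * e) (by fun_prop) (by simp) hδF
    have h0 : ∀ᶠ e in 𝓝[>] (0 : ℝ), 0 < e := eventually_mem_nhdsWithin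
    obtain ⟨ε₀, hε₀⟩ := (h0.and (h1.and (h2.and (h3.and h4)))).exists
    exact ⟨ε₀, hε₀.1, hε₀.2.1, hε₀.2.2.1, hε₀.2.2.2.1, hε₀.2.2.2.2⟩
  -- STEP 2: `εreg = ε₂₉ = t > 0` small against the five remaining constraints
  set c3 : ℝ := 143 * (((((d + 4 : ℕ) : ℝ)) ^ 2 / 4) ^ 2) with hc3
  set D : ℝ := 2 * δ / ((((d + 4) * L : ℕ) : ℝ)) ^ 2 with hD
  have hD0 : 0 < D := by
    have : (0 : ℝ) < ((((d + 4) * L : ℕ) : ℝ)) ^ 2 := by positivity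
    rw [hD]; positivity
  set ℓ : ℝ := ((((d + 2) * L : ℕ) : ℝ)) with hℓ
  set Λ : ℝ := ((L : ℝ)) ^ (d - 1) with hΛdef
  have g1 := eventually_nhdsGT_lt_of_continuousAt (g := fun t : ℝ => c3 * t) (by fun_prop) (by simp) (C := 1 / 3) (by norm_num)
  have g2 := eventually_nhdsGT_lt_of_continuousAt (g := fun t : ℝ => 2 * t) (by fun_prop) (by simp) hD0
  have g3 := eventually_nhdsGT_lt_of_continuousAt (g := fun t : ℝ => 1640 * (2 * (ℓ * t) + A * (2 * t / (L : ℝ) ^ 2)) * Λ ^ 2) (by fun_prop) (by simp)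
    (C := 1) one_pos
  have g4 := eventually_nhdsGT_lt_of_continuousAt (g := fun t : ℝ => 13 * (2 * (ℓ * t) + A * (2 * t / (L : ℝ) ^ 2)) * Λ) (by fun_prop) (by simp) hδ
  have g5 := eventually_nhdsGT_lt_of_continuousAt (g := fun t : ℝ => 2 * t / (L : ℝ) ^ 2 + 4 * max t (10 * (ℓ * t) * Λ))
    (by fun_prop) (by simp) hε₀
  have g0 : ∀ᶠ t in 𝓝[>] (0 : ℝ), 0 < t := eventually_mem_nhdsWithin
  obtain ⟨t, ht0, ht1, ht2, ht3, ht4, ht5⟩ := (g0.and (g1.and (g2.and (g3.and (g4.and g5))))).exists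
  refine ⟨t, t, ε₀, ht0, ht0, hε₀, ht1.le, ht2.le, ht3.le, ht4, ht5.le, h24, h64, h157, hF⟩

end A6

end Summit.QuantumFields.YangMills.BalabanUVNodes.N09WindowRadiusOfRecord

end
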